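import Summits.Ventures.CertifiedQuantumChemistry.Rows.SpinClassRows
import Summits.Ventures.CertifiedQuantumChemistry.Rows.SpinSectors
import Summits.Ventures.CertifiedQuantumChemistry.Rows.NSector
import Literature.MathematicalPhysics.QuantumChemistry.SectorRayleighRitz
import HarnessLib

/-!
# Ventures/CertifiedQuantumChemistry — Rows/SpinClassLadderRows.lean: the spin-class rows of
# `Rows/SpinClassRows.lean` versus the SECTOR rows — `E(a, b) ≤ E₀(a, b, S = M)`, the one-step `Ŝ_+` ladder
# `E(a, b+1) = min (E₀(a, b+1, S = M), E(a+1, b))`, and the row readings (P6 / T7 of the RANK-1 byte)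

HONEST FRAMING (verbatim): certified bounds for a stated model Hamiltonian in a stated basis; not a
claim about the real molecule or material beyond that model.

Typer seat chem-type-07 (slot 07), zero compute, nothing landed is touched; PROVED glue only (0 sorry, no
definition, no claim node, nothing here asserts any bound). Second half of the spin-class row vocabulary
(split from `Rows/SpinClassRows.lean` for the 400-line rule): that file defines `spinClassSector k a b`,
`Model.spinClassEnergy F a b = E₀(H_F; a, b, S = M)`, `SpinClassLowerRow / SpinClassUpperRow /
SpinClassBracket` and proves their SOUNDNESS for an arbitrary class-necessary condition set (the reading of
a K14-PIN-R1 ARM-A / ARM-B certificate as a DOUBLET-CLASS lower row). This file relates the class quantity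
to the venture's SECTOR quantity `Model.energy F a b` (`Statement.lean`):

* §2 CLASS versus SECTOR: `Model.energy_le_spinClassEnergy` (`E(a, b) ≤ E₀(a, b, S = M)` for `b ≤ a ≤ k`:
  the class is a nonzero `H_F`-invariant subspace of the sector), hence `LowerRow.spinClass` (a sector
  `L` is a class `L`) and `SpinClassUpperRow.upperRow` (a class `U` is a sector `U`).
* §3 THE LADDER STEP from an arbitrary sector (Lieb–Mattis 1962 §I; Lieb 1989 proof of Thm 1; the tree's
  state-level `spinPlus_mulVec_eq_zero_or_sectorGroundEnergy_le_of_sector` of `Rows/SpinOneGroundState.lean`,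
  re-derived privately here to keep the import closure small): `Model.min_spinClassEnergy_energy_le` —
  `min (E₀(a, b+1, S = M), E(a+1, b)) ≤ E(a, b+1)`, and for `b + 1 ≤ a`, `a + 1 ≤ k` the equality
  `Model.energy_eq_min_spinClassEnergy_energy` — **`E(a, b+1) = min (E₀(a, b+1, S = M), E(a+1, b))`**
  (e.g. T01a's doublet sector: `E(10, 9) = min (E₀(N = 19, S = ½), E(11, 8))`; the tree had the balanced
  case `Model.energy_eq_min_singletEnergy_energy`, `Rows/SingletVersusSector.lean`).
* §4 ROW READINGS — `SpinClassLowerRow.lowerRow_min` (a class `L` and an `(a+1, b)` sector `L` give the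
  sector row `LowerRow F a (b+1) (min lo lo')`, no spin hypothesis); the CERTIFIED-`S = M` readings under
  one certified gap `U(a, b+1) = hi < lo' = L(a+1, b)` — this IS the K14-PIN-R1 spec's leg P6 «the (10,9)
  ground multiplet is `S = ½`» as two rows (e.g. a certified `(11, 8)` `L` above the `(10, 9)` `U` of
  record): `UpperRow.energy_eq_spinClassEnergy_of_gap` (`E(a, b+1) = E₀(a, b+1, S = M) < E(a+1, b)`),
  **`SpinClassLowerRow.lowerRow_of_gap`** (then the class `L` IS a sector `L` — «L′ | P6» with P6 bought
  becomes a row on the sector key), `UpperRow.spinClassUpperRow_of_gap`, `SpinClassLowerRow.bracket_of_gap`,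
  `…spinClassBracket_of_gap`, `spinPlus_mulVec_eq_zero_of_gap_of_sector` (every ground vector of the sector
  is a highest-weight vector, total spin exactly `M`); and the OPPOSITE reading
  `SpinClassLowerRow.energy_eq_energy_succ_of_lt` (a class `L` strictly above a sector `U` of the same
  sector certifies `E(a, b+1) = E(a+1, b) < E₀(a, b+1, S = M)`: the ground multiplet has spin `> M` — the
  spec's tripwire T7 «a certified `L′ > U_el` refutes P6 for this MODEL», never a chemistry claim), with
  `SpinClassLowerRow.bracket_of_lt_of_bracket_succ`.
Nothing in this file is specific to T01a; no row of CERTIFIED-CHEM.md uses it today. References: E. H.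
Lieb, PRL 62 (1989) 1201, proof of Thm 1 (sectors, the `Ŝ_±` ladder); D. A. Mazziotti, Adv. Chem. Phys.
134 (2007) ch. 3 §II.F.1; T. Helgaker, P. Jørgensen, J. Olsen (2000) §2.4.1 (`[H, Ŝ_±] = 0`).
WHAT THIS IS NOT: not a certificate, not a bound on any model, not a statement about the real ion; class
rows and sector rows are DIFFERENT quantities — §4 states the certified legs under which they coincide.
-/

noncomputable section

namespace Summit.Ventures.CertifiedQuantumChemistry

open Matrix Finset
open Literature.MathematicalPhysics.QuantumLattice Literature.MathematicalPhysics.QuantumChemistry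
open scoped ComplexOrder

variable {k : ℕ}


/-! ## §2 Class versus sector: `E(a, b) ≤ E₀(a, b, S = M)` -/

/-- **`E(a, b) ≤ E₀(H_F; a, b, S = M)`** for a symmetric model and `b ≤ a ≤ k`: the spin class is a
nonzero `H_F`-invariant subspace of the sector (it contains the high-spin determinant; `[H_F, N̂] =
[H_F, Ŝ_z] = [H_F, Ŝ_+] = 0`), so its lowest eigenvalue is a Rayleigh value of the sector. Equality iff the
sector's ground multiplet has spin exactly `M` — NOT a theorem of the model (§4 gives the certified legs).
The `a = b` case is `Model.energy_le_singletEnergy`. [cite: LiebPRL1989, proof of Theorem 1] -/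
theorem Model.energy_le_spinClassEnergy {F : Model k} (hF : F.IsSymmetric) {a b : ℕ} (hba : b ≤ a)
    (ha : a ≤ k) : F.energy a b ≤ F.spinClassEnergy a b := by
  have hH := Model.hamiltonian_isHermitian hF
  obtain ⟨ψ, hψK, hψ1, hHψ⟩ := exists_unit_eigen_minEnergyOn hH (spinClassSector k a b)
    (fun v hv => mulVec_mem_szSector_inf_ker_spinPlus (molecularHamiltonian_commute_totalNumber _ _ _)
      (molecularHamiltonian_commute_spinZ _ _ _) (molecularHamiltonian_commute_spinPlus _ _ _) hv)
    (szSector_inf_ker_spinPlus_ne_bot_of_le hba (by simpa using ha))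
  have hψ : IsInSector a b ψ := ((mem_spinClassSector_iff ψ).1 hψK).1
  have hle := sectorGroundEnergy_mul_le_re_rayleigh hH hψ
  rw [hψ1, Complex.one_re, mul_one] at hle
  change F.hamiltonian *ᵥ ψ = ((F.spinClassEnergy a b : ℝ) : ℂ) • ψ at hHψ
  rw [hHψ, dotProduct_smul, hψ1, smul_eq_mul, mul_one, Complex.ofReal_re] at hle
  exact hle

/-- **A SECTOR lower row is a spin-class lower row** (`b ≤ a`): `LowerRow F a b lo ⟹ SpinClassLowerRow
F a b lo`, since `E(a, b) ≤ E₀(a, b, S = M)`. (So every sector `L` of record on a doublet key is already a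
valid — weaker-quantity — doublet-class `L`.) [cite: LiebPRL1989, proof of Theorem 1] -/
theorem LowerRow.spinClass {F : Model k} (hF : F.IsSymmetric) {a b : ℕ} {lo : ℚ} (h : LowerRow F a b lo)
    (hba : b ≤ a) : SpinClassLowerRow F a b lo :=
  ⟨hba, h.range.1, h.le.trans (Model.energy_le_spinClassEnergy hF hba h.range.1)⟩

/-- **A spin-class UPPER row is a sector upper row**: `SpinClassUpperRow F a b hi ⟹ UpperRow F a b hi`
(a trial state of spin `S = M` is a trial state of the sector). [cite: LiebPRL1989, proof of Theorem 1] -/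
theorem SpinClassUpperRow.upperRow {F : Model k} (hF : F.IsSymmetric) {a b : ℕ} {hi : ℚ}
    (h : SpinClassUpperRow F a b hi) : UpperRow F a b hi :=
  ⟨h.range.2, h.range.1.trans h.range.2,
    (Model.energy_le_spinClassEnergy hF h.range.1 h.range.2).trans h.le⟩

/-- A spin-class lower row and a SECTOR upper row of the same sector bracket the class quantity from
both sides only through `E(a,b) ≤ E₀(a,b,S=M) ≤ ?` — they do NOT form a bracket of one quantity; what
they do give is the ORDER `lo ≤ E₀(a, b, S = M)` and `E(a, b) ≤ hi`, recorded here as the harmless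
conjunction for bookkeeping (cf. §4 for when the two quantities coincide). [cite: LiebPRL1989, proof of Theorem 1] -/
theorem SpinClassLowerRow.le_and_le_of_upperRow {F : Model k} {a b : ℕ} {lo hi : ℚ}
    (hS : SpinClassLowerRow F a b lo) (hU : UpperRow F a b hi) :
    ((lo : ℚ) : ℝ) ≤ F.spinClassEnergy a b ∧ F.energy a b ≤ ((hi : ℚ) : ℝ) :=
  ⟨hS.le, hU.le⟩

/-! ## §3 The `Ŝ_+` ladder step from an arbitrary sector: `E(a, b+1) = min (E₀(a, b+1, S = M), E(a+1, b))` -/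

section Generic

variable {Λ : Type*} [LinearOrder Λ] [Fintype Λ]

/-- One `Ŝ_+` step from the sector `(a, b+1)` (the tree's
`spinPlus_mulVec_eq_zero_or_sectorGroundEnergy_le_of_sector`, `Rows/SpinOneGroundState.lean`, re-derived
privately to keep this file's import closure small): an eigenvector `χ` of a Hermitian `H` commuting with
`Ŝ_+`, eigenvalue `E`, has `Ŝ_+χ = 0` or `E(a+1, b) ≤ E` (`Ŝ_+χ` is then a nonzero eigenvector of the
next sector with the same eigenvalue). Lieb 1989, proof of Thm 1. -/
private theorem spinPlus_mulVec_eq_zero_or_le_step {H : Matrix (Finset (Orb Λ)) (Finset (Orb Λ)) ℂ}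
    (hH : H.IsHermitian) (hcommP : Commute H spinPlus) {a b : ℕ} {χ : Fock (Orb Λ)}
    (hχ : IsInSector a (b + 1) χ) {E : ℝ} (hHχ : H *ᵥ χ = ((E : ℝ) : ℂ) • χ) :
    spinPlus *ᵥ χ = 0 ∨ sectorGroundEnergy H (a + 1) b ≤ E := by
  by_cases h0 : spinPlus *ᵥ χ = 0
  · exact Or.inl h0
  · refine Or.inr ?_
    have hφs : IsInSector (a + 1) b (spinPlus *ᵥ χ) :=
      LiebThm1.raisesSpin_spinPlus.isInSector_mulVec hχ
    have hHφ : H *ᵥ (spinPlus *ᵥ χ) = ((E : ℝ) : ℂ) • (spinPlus *ᵥ χ) := by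
      rw [mulVec_mulVec, hcommP.eq, ← mulVec_mulVec, hHχ, mulVec_smul]
    exact sectorGroundEnergy_le_of_rayleigh hH hφs h0
      (by rw [hHφ, dotProduct_smul, smul_eq_mul, Complex.re_ofReal_mul])

end Generic

/-- **`min ( E₀(H_F; a, b+1, S = M), E(a+1, b) ) ≤ E(a, b+1)`** for a symmetric model, `a ≤ k`,
`b + 1 ≤ k`: a ground vector `χ` of the `(a, b+1)` sector is an eigenvector of `H_F`; either `Ŝ_+χ = 0`,
so `χ` lies in the spin class and its Rayleigh value `E(a, b+1)` bounds the class quantity from above, or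
`Ŝ_+χ ≠ 0` is an eigenvector with the SAME eigenvalue in the `(a+1, b)` sector (`[H_F, Ŝ_+] = 0`), a trial
state there (the tree's `spinPlus_mulVec_eq_zero_or_sectorGroundEnergy_le_of_sector`; Lieb–Mattis 1962 §I,
Lieb 1989 proof of Thm 1). The balanced case is `Model.min_singletEnergy_energy_le`.
[cite: LiebPRL1989, proof of Theorem 1] -/
theorem Model.min_spinClassEnergy_energy_le {F : Model k} (hF : F.IsSymmetric) {a b : ℕ} (ha : a ≤ k)
    (hb : b + 1 ≤ k) : min (F.spinClassEnergy a (b + 1)) (F.energy (a + 1) b) ≤ F.energy a (b + 1) := by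
  have hH := F.hamiltonian_isHermitian hF
  obtain ⟨⟨χ, hχ, hχ0, hHχ⟩, -⟩ := upDownSector_groundState_of_preservesSectors (a := a) (b := b + 1) hH
    F.preservesSectors_hamiltonian (by rw [Fintype.card_fin]; exact ha) (by rw [Fintype.card_fin]; exact hb)
  rw [← sectorGroundEnergy_def] at hHχ
  rcases spinPlus_mulVec_eq_zero_or_le_step hH
      (molecularHamiltonian_commute_spinPlus _ _ _) hχ hHχ with h0 | hle
  · exact (min_le_left _ _).trans
      (minEnergyOn_le_of_eigenvector hH _ ((mem_spinClassSector_iff χ).2 ⟨hχ, h0⟩) hχ0 hHχ)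
  · exact (min_le_right _ _).trans hle

/-- **`E(a, b+1) ≤ E(a+1, b)`** for `b + 1 ≤ a` (raising `|S_z|` at fixed `N` does not lower the sector
energy; one instance of `Model.energy_le_energy_of_max_le`), `a + 1 ≤ k`. [cite: LiebPRL1989, proof of Theorem 1] -/
theorem Model.energy_le_energy_succ {F : Model k} (hF : F.IsSymmetric) {a b : ℕ} (hba : b + 1 ≤ a)
    (ha : a + 1 ≤ k) : F.energy a (b + 1) ≤ F.energy (a + 1) b :=
  Model.energy_le_energy_of_max_le hF ha (by omega) (by omega) (by omega)

/-- **`E(a, b+1) = min ( E₀(H_F; a, b+1, S = M), E(a+1, b) )`** for a symmetric model, `b + 1 ≤ a`,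
`a + 1 ≤ k`: the energy of a sector with `M = (a − b − 1)/2 ≥ 0` is the energy of its spin class `S = M`
or the energy of the next sector up the `Ŝ_+` ladder, whichever is smaller. (E.g. T01a's doublet sector:
`E(10, 9) = min (E₀(N = 19, S = ½), E(11, 8))`.) The balanced case is
`Model.energy_eq_min_singletEnergy_energy`. [cite: LiebPRL1989, proof of Theorem 1] -/
theorem Model.energy_eq_min_spinClassEnergy_energy {F : Model k} (hF : F.IsSymmetric) {a b : ℕ}
    (hba : b + 1 ≤ a) (ha : a + 1 ≤ k) :
    F.energy a (b + 1) = min (F.spinClassEnergy a (b + 1)) (F.energy (a + 1) b) :=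
  le_antisymm (le_min (Model.energy_le_spinClassEnergy hF hba (by omega))
    (Model.energy_le_energy_succ hF hba ha)) (Model.min_spinClassEnergy_energy_le hF (by omega) (by omega))

/-! ## §4 Row readings -/

/-- **A spin-class `L` and a next-sector `L` give a SECTOR `L`** (no assumption on the spin of the ground
state): `SpinClassLowerRow F a (b+1) lo`, `LowerRow F (a+1) b lo'` ⟹ `LowerRow F a (b+1) (min lo lo')`.
(For K14-PIN-R1: a doublet-class `L′` on `(10, 9)` and ANY certified `(11, 8)` sector `L` give the sector
row `min`.) The balanced case is `SingletLowerRow.lowerRow_min`. [cite: LiebPRL1989, proof of Theorem 1] -/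
theorem SpinClassLowerRow.lowerRow_min {F : Model k} (hF : F.IsSymmetric) {a b : ℕ} {lo lo' : ℚ}
    (hS : SpinClassLowerRow F a (b + 1) lo) (hL : LowerRow F (a + 1) b lo') :
    LowerRow F a (b + 1) (min lo lo') := by
  refine ⟨hS.range.2, hS.range.1.trans hS.range.2, ?_⟩
  rw [Rat.cast_min]
  exact (min_le_min hS.le hL.le).trans
    (Model.min_spinClassEnergy_energy_le hF hS.range.2 (hS.range.1.trans hS.range.2))

/-- The energy form of a certified one-step gap: `UpperRow F a (b+1) hi`, `LowerRow F (a+1) b lo'`,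
`hi < lo'` ⟹ `E(a, b+1) < E(a+1, b)`. -/
theorem UpperRow.energy_lt_energy_succ_of_gap {F : Model k} {a b : ℕ} {hi lo' : ℚ}
    (hU : UpperRow F a (b + 1) hi) (hL : LowerRow F (a + 1) b lo') (hgap : hi < lo') :
    F.energy a (b + 1) < F.energy (a + 1) b :=
  lt_of_le_of_lt hU.le (lt_of_lt_of_le (by exact_mod_cast hgap) hL.le)

/-- **CERTIFIED `S = M` GROUND STATE** (the spec's leg P6 as two rows): a sector UPPER row
`UpperRow F a (b+1) hi` and a next-sector LOWER row `LowerRow F (a+1) b lo'` with `hi < lo'` prove, for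
`b + 1 ≤ a`, `E(a, b+1) = E₀(H_F; a, b+1, S = M)` and `E₀(a, b+1, S = M) < E(a+1, b)` — the ground multiplet
of the `(a, b+1)` sector has total spin exactly `M = (a − b − 1)/2`. (T01a: a `(10, 9)` `U` of record below a
certified `(11, 8)` `L` ⇒ the model's 19-electron ground state in `S_z = ½` is a doublet.) The balanced
case is `SingletUpperRow.energy_eq_singletEnergy_of_gap`'s sector form. [cite: LiebPRL1989, proof of Theorem 1] -/
theorem UpperRow.energy_eq_spinClassEnergy_of_gap {F : Model k} (hF : F.IsSymmetric) {a b : ℕ}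
    {hi lo' : ℚ} (hU : UpperRow F a (b + 1) hi) (hL : LowerRow F (a + 1) b lo') (hgap : hi < lo')
    (hba : b + 1 ≤ a) :
    F.energy a (b + 1) = F.spinClassEnergy a (b + 1) ∧ F.spinClassEnergy a (b + 1) < F.energy (a + 1) b := by
  have hlt := hU.energy_lt_energy_succ_of_gap hL hgap
  have hle := Model.energy_le_spinClassEnergy hF hba hU.range.1
  rcases min_le_iff.1 (Model.min_spinClassEnergy_energy_le hF hU.range.1 hU.range.2) with h | h
  · exact ⟨le_antisymm hle h, lt_of_le_of_lt h hlt⟩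
  · exact absurd h (not_le.2 hlt)

/-- **Under a certified `S = M` ground state the spin-class `L` IS a sector `L`**: `SpinClassLowerRow F a
(b+1) lo`, `UpperRow F a (b+1) hi`, `LowerRow F (a+1) b lo'`, `hi < lo'` ⟹ `LowerRow F a (b+1) lo`. (The
K14-PIN-R1 letter «… | P6» with P6 bought: `L′` becomes a row on the sector key.)
[cite: LiebPRL1989, proof of Theorem 1] -/
theorem SpinClassLowerRow.lowerRow_of_gap {F : Model k} (hF : F.IsSymmetric) {a b : ℕ} {lo hi lo' : ℚ}
    (hS : SpinClassLowerRow F a (b + 1) lo) (hU : UpperRow F a (b + 1) hi)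
    (hL : LowerRow F (a + 1) b lo') (hgap : hi < lo') : LowerRow F a (b + 1) lo :=
  ⟨hU.range.1, hU.range.2, by
    rw [(hU.energy_eq_spinClassEnergy_of_gap hF hL hgap hS.range.1).1]; exact hS.le⟩

/-- **Under a certified `S = M` ground state a sector `U` is a spin-class `U`**: `UpperRow F a (b+1) hi`,
`LowerRow F (a+1) b lo'`, `hi < lo'`, `b + 1 ≤ a` ⟹ `SpinClassUpperRow F a (b+1) hi`.
[cite: LiebPRL1989, proof of Theorem 1] -/
theorem UpperRow.spinClassUpperRow_of_gap {F : Model k} (hF : F.IsSymmetric) {a b : ℕ} {hi lo' : ℚ}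
    (hU : UpperRow F a (b + 1) hi) (hL : LowerRow F (a + 1) b lo') (hgap : hi < lo')
    (hba : b + 1 ≤ a) : SpinClassUpperRow F a (b + 1) hi :=
  ⟨hba, hU.range.1, by rw [← (hU.energy_eq_spinClassEnergy_of_gap hF hL hgap hba).1]; exact hU.le⟩

/-- **Bracket reading**: a spin-class `L`, a sector `U` and a certified one-step gap give the SECTOR
bracket `Bracket F a (b+1) lo hi` (and, by `UpperRow.spinClassUpperRow_of_gap`, the class bracket too).
[cite: LiebPRL1989, proof of Theorem 1] -/
theorem SpinClassLowerRow.bracket_of_gap {F : Model k} (hF : F.IsSymmetric) {a b : ℕ} {lo hi lo' : ℚ}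
    (hS : SpinClassLowerRow F a (b + 1) lo) (hU : UpperRow F a (b + 1) hi)
    (hL : LowerRow F (a + 1) b lo') (hgap : hi < lo') : Bracket F a (b + 1) lo hi :=
  ⟨hS.lowerRow_of_gap hF hU hL hgap, hU⟩

/-- The same legs give the spin-class bracket `SpinClassBracket F a (b+1) lo hi`. [cite: LiebPRL1989, proof of Theorem 1] -/
theorem SpinClassLowerRow.spinClassBracket_of_gap {F : Model k} (hF : F.IsSymmetric) {a b : ℕ}
    {lo hi lo' : ℚ} (hS : SpinClassLowerRow F a (b + 1) lo) (hU : UpperRow F a (b + 1) hi)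
    (hL : LowerRow F (a + 1) b lo') (hgap : hi < lo') : SpinClassBracket F a (b + 1) lo hi :=
  ⟨hS, hU.spinClassUpperRow_of_gap hF hL hgap hS.range.1⟩

/-- **Ground vectors are highest-weight vectors under the certified gap**: with `UpperRow F a (b+1) hi`,
`LowerRow F (a+1) b lo'`, `hi < lo'`, every eigenvector `χ` of `H_F` in the `(a, b+1)` sector at the sector
energy satisfies `Ŝ_+χ = 0` (total spin exactly `M`; the same statement as the tree's
`spinPlus_mulVec_eq_zero_of_lt_of_sector` / `DiffLowerRow.spinPlus_mulVec_eq_zero_of_pos_step`, here with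
the strict gap supplied by the two rows). [cite: LiebPRL1989, proof of Theorem 1] -/
theorem spinPlus_mulVec_eq_zero_of_gap_of_sector {F : Model k} (hF : F.IsSymmetric) {a b : ℕ}
    {hi lo' : ℚ} (hU : UpperRow F a (b + 1) hi) (hL : LowerRow F (a + 1) b lo') (hgap : hi < lo')
    {χ : Fock (Orb (Fin k))} (hχ : IsInSector a (b + 1) χ)
    (hHχ : F.hamiltonian *ᵥ χ = ((F.energy a (b + 1) : ℝ) : ℂ) • χ) : spinPlus *ᵥ χ = 0 :=
  (spinPlus_mulVec_eq_zero_or_le_step (F.hamiltonian_isHermitian hF)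
    (molecularHamiltonian_commute_spinPlus _ _ _) hχ hHχ).resolve_right
    (not_le.2 (hU.energy_lt_energy_succ_of_gap hL hgap))

/-- **THE OPPOSITE READING (tripwire T7): a spin-class `L` strictly ABOVE a sector `U` of the same
sector certifies a NON-`S = M` ground multiplet.** `SpinClassLowerRow F a (b+1) lo`, `UpperRow F a (b+1)
hi`, `hi < lo`, `a + 1 ≤ k` ⟹ `E(a, b+1) = E(a+1, b)` and `E(a, b+1) < E₀(a, b+1, S = M)`: the sector's
ground states have spin `> M`, and the `(a+1, b)` sector carries the same energy. (For K14-PIN-R1: a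
certified `L′` above the `(10, 9)` `U` of record would REFUTE P6 for the MODEL — the 19-electron ground
state in `S_z = ½` would not be a doublet — never a chemistry claim.) The balanced case is
`SingletLowerRow.energy_eq_energy_of_gap`. [cite: LiebPRL1989, proof of Theorem 1] -/
theorem SpinClassLowerRow.energy_eq_energy_succ_of_lt {F : Model k} (hF : F.IsSymmetric) {a b : ℕ}
    {lo hi : ℚ} (hS : SpinClassLowerRow F a (b + 1) lo) (hU : UpperRow F a (b + 1) hi) (hgap : hi < lo)
    (ha : a + 1 ≤ k) :
    F.energy a (b + 1) = F.energy (a + 1) b ∧ F.energy a (b + 1) < F.spinClassEnergy a (b + 1) := by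
  have hlt : F.energy a (b + 1) < F.spinClassEnergy a (b + 1) :=
    lt_of_le_of_lt hU.le (lt_of_lt_of_le (by exact_mod_cast hgap) hS.le)
  have hle := Model.energy_le_energy_succ hF hS.range.1 ha
  rcases min_le_iff.1 (Model.min_spinClassEnergy_energy_le hF hU.range.1 hU.range.2) with h | h
  · exact absurd h (not_le.2 hlt)
  · exact ⟨le_antisymm hle h, hlt⟩

/-- Under that opposite reading an `(a+1, b)` bracket is an `(a, b+1)` bracket (same energy).
[cite: LiebPRL1989, proof of Theorem 1] -/
theorem SpinClassLowerRow.bracket_of_lt_of_bracket_succ {F : Model k} (hF : F.IsSymmetric) {a b : ℕ}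
    {lo hi lo₁ hi₁ : ℚ} (hS : SpinClassLowerRow F a (b + 1) lo) (hU : UpperRow F a (b + 1) hi)
    (hgap : hi < lo) (hB : Bracket F (a + 1) b lo₁ hi₁) : Bracket F a (b + 1) lo₁ hi₁ := by
  have heq := (hS.energy_eq_energy_succ_of_lt hF hU hgap hB.1.range.1).1
  exact ⟨⟨hU.range.1, hU.range.2, by rw [heq]; exact hB.1.le⟩,
    ⟨hU.range.1, hU.range.2, by rw [heq]; exact hB.2.le⟩⟩

end Summit.Ventures.CertifiedQuantumChemistry

end
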